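import Summits.Ventures.Crystal3D.Theorems.StickyWulffConstantPolycrystalWulffBoundSubfamilyPerimeter

/-!
# `PolycrystalWulffBound`: MERGING calculus — interfaces are additive over disjoint unions of
# grains, and the free energy of a same-body class is that of the merged grain

Route `StickyWulffConstant` of the venture `Summits/Ventures/Crystal3D`, crux `PolycrystalWulffBound`
(item `stmt-Ventures-19482`), second prover lane (poly-p2).  For pairwise disjoint polyhedral grains
`G : Fin n → Set E3` of finite volume and an origin-symmetric compact convex body `K ∋ 0`
(`ι_K(S₁, S₂) = (per K S₁ + per K S₂ − per K (S₁ ∪ S₂))/2`):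

* `two_iota_biUnion_left` — for `I : Finset (Fin n)` and `g ∉ I`:
  `2 ι_K(⋃_{f∈I} G f, G g) = Σ_{f∈I} 2 ι_K(G f, G g)` (the interface with a merged grain is the sum
  of the interfaces);
* `freeEnergy_class_eq_merged` — for `I : Finset (Fin n)`:
  `Σ_{f∈I} [per K (G f) − Σ_{g ≠ f} ι_K(G f, G g)] = per K (⋃_I G) − Σ_{g ∉ I} ι_K(⋃_I G, G g)`:
  the free energy (one common body `K` on the class `I`) is INVARIANT under merging the class into
  one grain — the bookkeeping behind «walls between grains of the same lattice are free; merge them»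
  (P-LINE §1 padding/merging, §3 `rung_twinFree`), derived from inclusion–exclusion
  (`per_biUnion_eq_sum_sub_sum_iota`).
WHAT THIS IS NOT: a result on grains in contact beyond bookkeeping; the crux is not claimed.
-/

noncomputable section

namespace Summit.Ventures.Crystal3D.Theorems

open MeasureTheory Set Metric
open scoped RealInnerProductSpace ENNReal Pointwise
open Summit.Ventures.Crystal3D.Cruxes.TextureLiminf.TexShadow
open Literature.Analysis.Convexity

/-- The crux's pair kernel `(f, g) ↦ if f = g then 0 else ι_K(G f, G g)` is symmetric. -/
theorem iota_kernel_symm (K : Set E3) {n : ℕ} (G : Fin n → Set E3) (f g : Fin n) :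
    (if f = g then (0 : ℝ) else (per K (G f) + per K (G g) - per K (G f ∪ G g)) / 2) =
      (if g = f then 0 else (per K (G g) + per K (G f) - per K (G g ∪ G f)) / 2) := by
  by_cases hfg : f = g
  · rw [if_pos hfg, if_pos hfg.symm]
  · rw [if_neg hfg, if_neg (Ne.symm hfg), union_comm]
    ring

/-- Splitting the pair sum over `insert g I` (`g ∉ I`) for a symmetric kernel vanishing on the
diagonal: `Σ_{insert g I}² T = Σ_{I²} T + 2 Σ_{f∈I} T f g`. -/
theorem sum_sum_insert_of_symm {n : ℕ} (T : Fin n → Fin n → ℝ) (hsymm : ∀ f g, T f g = T g f)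
    (hdiag : ∀ f, T f f = 0) {I : Finset (Fin n)} {g : Fin n} (hg : g ∉ I) :
    (∑ f ∈ insert g I, ∑ f' ∈ insert g I, T f f') =
      (∑ f ∈ I, ∑ f' ∈ I, T f f') + 2 * ∑ f ∈ I, T f g := by
  rw [Finset.sum_insert hg]
  simp_rw [Finset.sum_insert hg]
  rw [hdiag, zero_add, Finset.sum_add_distrib]
  have h : (∑ f ∈ I, T g f) = ∑ f ∈ I, T f g := Finset.sum_congr rfl fun f _ => hsymm g f
  rw [h]
  ring

/-- **Interfaces are additive over disjoint unions of grains.**  For pairwise disjoint polyhedral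
grains of finite volume, an origin-symmetric compact convex body `K ∋ 0`, `I : Finset (Fin n)` and
`g ∉ I`:
`per K (⋃_{f∈I} G f) + per K (G g) − per K ((⋃_{f∈I} G f) ∪ G g) = Σ_{f∈I} (per K (G f) + per K (G g) − per K (G f ∪ G g))`. -/
theorem two_iota_biUnion_left {n : ℕ} (G : Fin n → Set E3)
    (hPoly : ∀ f, ∃ (k : ℕ) (H : Fin k → Finset (E3 × ℝ)), G f = ⋃ i, polytope (H i))
    (hvol : ∀ f, volume (G f) < ⊤) (hdisjG : ∀ f g, f ≠ g → Disjoint (G f) (G g))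
    {K : Set E3} (hK : IsCompact K) (hKc : Convex ℝ K) (h0 : (0 : E3) ∈ K) (hKs : -K = K)
    {I : Finset (Fin n)} {g : Fin n} (hg : g ∉ I) :
    per K (⋃ f ∈ I, G f) + per K (G g) - per K ((⋃ f ∈ I, G f) ∪ G g) =
      ∑ f ∈ I, (per K (G f) + per K (G g) - per K (G f ∪ G g)) := by
  classical
  set T : Fin n → Fin n → ℝ := fun f f' =>
    if f = f' then 0 else (per K (G f) + per K (G f') - per K (G f ∪ G f')) / 2 with hT
  have hsymm : ∀ f f', T f f' = T f' f := fun f f' => iota_kernel_symm K G f f'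
  have hdiag : ∀ f, T f f = 0 := fun f => by simp [hT]
  have hI : per K (⋃ f ∈ I, G f) = (∑ f ∈ I, per K (G f)) - ∑ f ∈ I, ∑ f' ∈ I, T f f' :=
    per_biUnion_eq_sum_sub_sum_iota G hPoly hvol hdisjG hK hKc h0 hKs I
  have hIg : per K (⋃ f ∈ insert g I, G f) =
      (∑ f ∈ insert g I, per K (G f)) - ∑ f ∈ insert g I, ∑ f' ∈ insert g I, T f f' :=
    per_biUnion_eq_sum_sub_sum_iota G hPoly hvol hdisjG hK hKc h0 hKs (insert g I)
  rw [Finset.set_biUnion_insert, union_comm, Finset.sum_insert hg,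
    sum_sum_insert_of_symm T hsymm hdiag hg] at hIg
  have hTg : ∀ f ∈ I, T f g = (per K (G f) + per K (G g) - per K (G f ∪ G g)) / 2 := by
    intro f hf
    have hfg : f ≠ g := fun h => hg (h ▸ hf)
    simp [hT, hfg]
  rw [Finset.sum_congr rfl hTg, ← Finset.sum_div] at hIg
  rw [hI, hIg]
  field_simp
  ring

/-- **The free energy of a same-body class equals that of the merged grain.**  For pairwise
disjoint polyhedral grains of finite volume, an origin-symmetric compact convex body `K ∋ 0` and a
class `I : Finset (Fin n)` of grains all carrying the body `K`:
`Σ_{f∈I} [per K (G f) − Σ_g (if f = g then 0 else ι_K(G f, G g))]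
   = per K (⋃_{f∈I} G f) − Σ_{g ∉ I} ι_K(⋃_{f∈I} G f, G g)`. -/
theorem freeEnergy_class_eq_merged {n : ℕ} (G : Fin n → Set E3)
    (hPoly : ∀ f, ∃ (k : ℕ) (H : Fin k → Finset (E3 × ℝ)), G f = ⋃ i, polytope (H i))
    (hvol : ∀ f, volume (G f) < ⊤) (hdisjG : ∀ f g, f ≠ g → Disjoint (G f) (G g))
    {K : Set E3} (hK : IsCompact K) (hKc : Convex ℝ K) (h0 : (0 : E3) ∈ K) (hKs : -K = K)
    (I : Finset (Fin n)) :
    (∑ f ∈ I, (per K (G f) - ∑ g, (if f = g then 0 else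
        (per K (G f) + per K (G g) - per K (G f ∪ G g)) / 2))) =
      per K (⋃ f ∈ I, G f) - ∑ g ∈ Finset.univ \ I,
        (per K (⋃ f ∈ I, G f) + per K (G g) - per K ((⋃ f ∈ I, G f) ∪ G g)) / 2 := by
  classical
  set T : Fin n → Fin n → ℝ := fun f f' =>
    if f = f' then 0 else (per K (G f) + per K (G f') - per K (G f ∪ G f')) / 2 with hT
  have hI : per K (⋃ f ∈ I, G f) = (∑ f ∈ I, per K (G f)) - ∑ f ∈ I, ∑ f' ∈ I, T f f' :=
    per_biUnion_eq_sum_sub_sum_iota G hPoly hvol hdisjG hK hKc h0 hKs I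
  -- split each inner sum over `I` and its complement
  have hsplit : ∀ f, (∑ g, T f g) = (∑ g ∈ I, T f g) + ∑ g ∈ Finset.univ \ I, T f g := by
    intro f
    rw [← Finset.sum_union (Finset.disjoint_sdiff), Finset.union_sdiff_of_subset (Finset.subset_univ I)]
  -- the interfaces with the merged grain
  have hmerge : ∀ g ∈ Finset.univ \ I,
      (per K (⋃ f ∈ I, G f) + per K (G g) - per K ((⋃ f ∈ I, G f) ∪ G g)) / 2 =
        ∑ f ∈ I, T f g := by
    intro g hg
    have hg' : g ∉ I := (Finset.mem_sdiff.1 hg).2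
    rw [two_iota_biUnion_left G hPoly hvol hdisjG hK hKc h0 hKs hg', Finset.sum_div]
    refine Finset.sum_congr rfl fun f hf => ?_
    have hfg : f ≠ g := fun h => hg' (h ▸ hf)
    simp [hT, hfg]
  rw [Finset.sum_congr rfl hmerge, Finset.sum_comm, hI]
  have hL : (∑ f ∈ I, (per K (G f) - ∑ g, T f g)) =
      (∑ f ∈ I, per K (G f)) - (∑ f ∈ I, ∑ g ∈ I, T f g) -
        ∑ f ∈ I, ∑ g ∈ Finset.univ \ I, T f g := by
    rw [Finset.sum_congr rfl fun f _ => by rw [hsplit f], Finset.sum_sub_distrib,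
      Finset.sum_add_distrib]
    ring
  rw [hL]

/-! ### Bilinearity over two merged classes; the free energy of the merged texture

(Appended 2026-08-27, poly-p2 g2.)  `two_iota_biUnion_biUnion` — bilinearity of the interface term
over two DISJOINT classes; `freeEnergy_eq_merged_texture` — the free energy of a texture equals that
of its MERGED texture (one grain per class): WLOG pairwise distinct bodies (lattices) as far as the
free energy is concerned. -/

/-- Splitting the pair sum over a disjoint union `I ∪ J` for a symmetric kernel:
`Σ_{(I∪J)²} T = Σ_{I²} T + Σ_{J²} T + 2 Σ_{I×J} T`. -/
theorem sum_sum_union_of_symm {n : ℕ} (T : Fin n → Fin n → ℝ) (hsymm : ∀ f g, T f g = T g f)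
    {I J : Finset (Fin n)} (hIJ : Disjoint I J) :
    (∑ f ∈ I ∪ J, ∑ f' ∈ I ∪ J, T f f') =
      (∑ f ∈ I, ∑ f' ∈ I, T f f') + (∑ f ∈ J, ∑ f' ∈ J, T f f') + 2 * ∑ f ∈ I, ∑ g ∈ J, T f g := by
  rw [Finset.sum_union hIJ]
  simp_rw [Finset.sum_union hIJ]
  rw [Finset.sum_add_distrib, Finset.sum_add_distrib]
  have h : (∑ f ∈ J, ∑ f' ∈ I, T f f') = ∑ f ∈ I, ∑ g ∈ J, T f g := by
    rw [Finset.sum_comm]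
    exact Finset.sum_congr rfl fun f _ => Finset.sum_congr rfl fun g _ => hsymm g f
  rw [h]
  ring

/-- **Interfaces are bilinear over disjoint unions of grains.**  For pairwise disjoint polyhedral
grains of finite volume, an origin-symmetric compact convex body `K ∋ 0` and DISJOINT index sets
`I, J`:
`per K (⋃_I G) + per K (⋃_J G) − per K ((⋃_I G) ∪ ⋃_J G) = Σ_{f∈I} Σ_{g∈J} (per K (G f) + per K (G g) − per K (G f ∪ G g))`
— twice the interface of two merged classes is the sum of the pairwise interfaces. -/
theorem two_iota_biUnion_biUnion {n : ℕ} (G : Fin n → Set E3)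
    (hPoly : ∀ f, ∃ (k : ℕ) (H : Fin k → Finset (E3 × ℝ)), G f = ⋃ i, polytope (H i))
    (hvol : ∀ f, volume (G f) < ⊤) (hdisjG : ∀ f g, f ≠ g → Disjoint (G f) (G g))
    {K : Set E3} (hK : IsCompact K) (hKc : Convex ℝ K) (h0 : (0 : E3) ∈ K) (hKs : -K = K)
    {I J : Finset (Fin n)} (hIJ : Disjoint I J) :
    per K (⋃ f ∈ I, G f) + per K (⋃ g ∈ J, G g) - per K ((⋃ f ∈ I, G f) ∪ ⋃ g ∈ J, G g) =
      ∑ f ∈ I, ∑ g ∈ J, (per K (G f) + per K (G g) - per K (G f ∪ G g)) := by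
  classical
  set T : Fin n → Fin n → ℝ := fun f f' =>
    if f = f' then 0 else (per K (G f) + per K (G f') - per K (G f ∪ G f')) / 2 with hT
  have hsymm : ∀ f f', T f f' = T f' f := fun f f' => iota_kernel_symm K G f f'
  have hI : per K (⋃ f ∈ I, G f) = (∑ f ∈ I, per K (G f)) - ∑ f ∈ I, ∑ f' ∈ I, T f f' :=
    per_biUnion_eq_sum_sub_sum_iota G hPoly hvol hdisjG hK hKc h0 hKs I
  have hJ : per K (⋃ f ∈ J, G f) = (∑ f ∈ J, per K (G f)) - ∑ f ∈ J, ∑ f' ∈ J, T f f' :=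
    per_biUnion_eq_sum_sub_sum_iota G hPoly hvol hdisjG hK hKc h0 hKs J
  have hU : per K (⋃ f ∈ I ∪ J, G f) = (∑ f ∈ I ∪ J, per K (G f)) -
      ∑ f ∈ I ∪ J, ∑ f' ∈ I ∪ J, T f f' :=
    per_biUnion_eq_sum_sub_sum_iota G hPoly hvol hdisjG hK hKc h0 hKs (I ∪ J)
  rw [Finset.set_biUnion_union, Finset.sum_union hIJ, sum_sum_union_of_symm T hsymm hIJ] at hU
  have hTfg : ∀ f ∈ I, ∀ g ∈ J, T f g = (per K (G f) + per K (G g) - per K (G f ∪ G g)) / 2 := by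
    intro f hf g hg
    have hfg : f ≠ g := fun h => Finset.disjoint_left.1 hIJ hf (h ▸ hg)
    simp [hT, hfg]
  have hcross : (∑ f ∈ I, ∑ g ∈ J, T f g) =
      (∑ f ∈ I, ∑ g ∈ J, (per K (G f) + per K (G g) - per K (G f ∪ G g))) / 2 := by
    rw [Finset.sum_div]
    refine Finset.sum_congr rfl fun f hf => ?_
    rw [Finset.sum_div]
    exact Finset.sum_congr rfl fun g hg => hTfg f hf g hg
  rw [hcross] at hU
  rw [hI, hJ, hU]
  ring

/-- **The free energy of a texture is that of its merged texture.**  For pairwise disjoint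
polyhedral grains of finite volume, a class map `cls : Fin n → κ` into a finite set of labels
`L ⊇ cls '' univ`, and bodies `Kc : κ → Set E3` (origin-symmetric compact convex `∋ 0`) with every
grain carrying the body of its class:
`Σ_f [per (Kc (cls f)) (G f) − Σ_g (if f = g then 0 else ι(G f, G g))]
   = Σ_{ℓ ∈ L} [per (Kc ℓ) (⋃_{cls f = ℓ} G f) − Σ_{ℓ' ∈ L} (if ℓ = ℓ' then 0 else ι(⋃_{cls = ℓ} G, ⋃_{cls = ℓ'} G))]`
(`ι` with the body of the class): merging every class into one grain leaves the free energy
unchanged — WLOG the grains of a texture carry pairwise distinct bodies (lattices) as far as the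
free energy is concerned. -/
theorem freeEnergy_eq_merged_texture {n : ℕ} (G : Fin n → Set E3)
    (hPoly : ∀ f, ∃ (k : ℕ) (H : Fin k → Finset (E3 × ℝ)), G f = ⋃ i, polytope (H i))
    (hvol : ∀ f, volume (G f) < ⊤) (hdisjG : ∀ f g, f ≠ g → Disjoint (G f) (G g))
    {κ : Type*} [DecidableEq κ] (cls : Fin n → κ) (L : Finset κ) (hL : ∀ f, cls f ∈ L)
    (Kc : κ → Set E3) (hKc : ∀ ℓ, IsCompact (Kc ℓ)) (hKv : ∀ ℓ, Convex ℝ (Kc ℓ))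
    (hK0 : ∀ ℓ, (0 : E3) ∈ Kc ℓ) (hKs : ∀ ℓ, -Kc ℓ = Kc ℓ) :
    (∑ f, (per (Kc (cls f)) (G f) - ∑ g, (if f = g then 0 else
        (per (Kc (cls f)) (G f) + per (Kc (cls f)) (G g) - per (Kc (cls f)) (G f ∪ G g)) / 2))) =
      ∑ ℓ ∈ L, (per (Kc ℓ) (⋃ f ∈ Finset.univ.filter (fun f => cls f = ℓ), G f) -
        ∑ ℓ' ∈ L, (if ℓ = ℓ' then 0 else
          (per (Kc ℓ) (⋃ f ∈ Finset.univ.filter (fun f => cls f = ℓ), G f) +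
            per (Kc ℓ) (⋃ f ∈ Finset.univ.filter (fun f => cls f = ℓ'), G f) -
            per (Kc ℓ) ((⋃ f ∈ Finset.univ.filter (fun f => cls f = ℓ), G f) ∪
              ⋃ f ∈ Finset.univ.filter (fun f => cls f = ℓ'), G f)) / 2)) := by
  classical
  have hmaps : ∀ f ∈ (Finset.univ : Finset (Fin n)), cls f ∈ L := fun f _ => hL f
  -- fiberwise on the left
  rw [← Finset.sum_fiberwise_of_maps_to hmaps]
  refine Finset.sum_congr rfl fun ℓ hℓ => ?_
  -- within class `ℓ`, every grain carries the body `Kc ℓ`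
  have hcl : (∑ f ∈ Finset.univ.filter (fun f => cls f = ℓ),
      (per (Kc (cls f)) (G f) - ∑ g, (if f = g then 0 else
        (per (Kc (cls f)) (G f) + per (Kc (cls f)) (G g) - per (Kc (cls f)) (G f ∪ G g)) / 2))) =
      ∑ f ∈ Finset.univ.filter (fun f => cls f = ℓ),
        (per (Kc ℓ) (G f) - ∑ g, (if f = g then 0 else
          (per (Kc ℓ) (G f) + per (Kc ℓ) (G g) - per (Kc ℓ) (G f ∪ G g)) / 2)) :=
    Finset.sum_congr rfl fun f hf => by rw [(Finset.mem_filter.1 hf).2]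
  rw [hcl, freeEnergy_class_eq_merged G hPoly hvol hdisjG (hKc ℓ) (hKv ℓ) (hK0 ℓ) (hKs ℓ)]
  congr 1
  -- the interfaces of the merged class `ℓ` with the grains outside it, class by class
  have hmaps' : ∀ g ∈ Finset.univ \ Finset.univ.filter (fun f => cls f = ℓ), cls g ∈ L :=
    fun g _ => hL g
  rw [← Finset.sum_fiberwise_of_maps_to hmaps']
  refine Finset.sum_congr rfl fun ℓ' _ => ?_
  by_cases hℓℓ' : ℓ = ℓ'
  · -- no grain outside class `ℓ` has class `ℓ`
    subst hℓℓ'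
    rw [if_pos rfl]
    refine Finset.sum_eq_zero fun g hg => ?_
    exfalso
    have hg' := Finset.mem_filter.1 hg
    exact (Finset.mem_sdiff.1 hg'.1).2 (Finset.mem_filter.2 ⟨Finset.mem_univ g, hg'.2⟩)
  · rw [if_neg hℓℓ']
    -- the grains outside class `ℓ` with class `ℓ'` are exactly class `ℓ'`
    have hfilt : (Finset.univ \ Finset.univ.filter (fun f => cls f = ℓ)).filter
        (fun g => cls g = ℓ') = Finset.univ.filter (fun f => cls f = ℓ') := by
      ext g
      simp only [Finset.mem_filter, Finset.mem_sdiff, Finset.mem_univ, true_and]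
      constructor
      · exact fun h => h.2
      · exact fun h => ⟨fun h' => hℓℓ' (h'.symm.trans h), h⟩
    rw [hfilt]
    have hdisjc : Disjoint (Finset.univ.filter (fun f => cls f = ℓ))
        (Finset.univ.filter (fun f => cls f = ℓ')) := by
      rw [Finset.disjoint_left]
      intro f hf hf'
      exact hℓℓ' ((Finset.mem_filter.1 hf).2.symm.trans (Finset.mem_filter.1 hf').2)
    rw [two_iota_biUnion_biUnion G hPoly hvol hdisjG (hKc ℓ) (hKv ℓ) (hK0 ℓ) (hKs ℓ) hdisjc,
      Finset.sum_div]
    simp_rw [Finset.sum_div]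
    rw [Finset.sum_comm]
    refine Finset.sum_congr rfl fun g hg => ?_
    have hg' : g ∉ Finset.univ.filter (fun f => cls f = ℓ) := fun h =>
      hℓℓ' ((Finset.mem_filter.1 h).2.symm.trans (Finset.mem_filter.1 hg).2)
    rw [two_iota_biUnion_left G hPoly hvol hdisjG (hKc ℓ) (hKv ℓ) (hK0 ℓ) (hKs ℓ) hg',
      Finset.sum_div]

end Summit.Ventures.Crystal3D.Theorems

end
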